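import Summits.KontsevichZagierPeriods.KontsevichZagierPeriods.Theorems.SoloBlindCauchyForm
import Literature.NumberTheory.Transcendental.SemialgebraicLineDeriv
import HarnessLib

/-!
# Cauchy's theorem inside the rules, II: the level-5 integrands are semialgebraic

For `e = p/5 - 1` the functions `P = Re g_e`, `Q = Im g_e` and `h = -Im g_e'`
(`g_e(z) = (z(1-z))^e`, see `SoloBlindCauchyForm`) are `ℚ`-semialgebraic functions of
`(x, y) = (Re z, Im z)` on the closed half-plane `x ≤ 1/2, y ≥ 0` minus the origin: there
`w = z(1-z)` lies in the closed upper half-plane minus `0`, `g_e = (w^{1/5})^p / w`, and the real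
and imaginary parts of the principal fifth root are semialgebraic (`SoloBlindFifthRoot`).  The
bookkeeping is a small kit: real/imaginary parts of products, inverses and powers of
complex-valued functions with semialgebraic real and imaginary parts are semialgebraic.

References: Bochnak–Coste–Roy, *Real Algebraic Geometry* (1998), Prop. 2.2.6;
Kontsevich–Zagier, *Periods* (2001), §1.1 (algebraic integrands).
-/

noncomputable section

namespace Summit.KontsevichZagierPeriods.KontsevichZagierPeriods.Theorems

open Set Complex
open Literature.ModelTheory.ExponentialFields (IsSemialgebraic isSemialgebraic_setOf_eval_pos
  isSemialgebraic_setOf_eval_nonneg isSemialgebraic_setOf_eval_ne_zero)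
open MvPolynomial (aeval X)
open Literature.NumberTheory.Transcendental

namespace SoloBlind

/-! ## Kit: real and imaginary parts of complex combinations -/

section Kit

variable {d : ℕ} {W : Set (Fin d → ℝ)} {F G : (Fin d → ℝ) → ℂ}

/-- Real and imaginary parts of a product. -/
theorem sa_mul (hFr : IsSemialgebraicFunOn ℚ W fun z => (F z).re)
    (hFi : IsSemialgebraicFunOn ℚ W fun z => (F z).im)
    (hGr : IsSemialgebraicFunOn ℚ W fun z => (G z).re)
    (hGi : IsSemialgebraicFunOn ℚ W fun z => (G z).im) :
    IsSemialgebraicFunOn ℚ W (fun z => (F z * G z).re) ∧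
      IsSemialgebraicFunOn ℚ W (fun z => (F z * G z).im) :=
  ⟨((hFr.fun_mul hGr).fun_sub (hFi.fun_mul hGi)).congr fun z _ => by simp [mul_re],
    ((hFr.fun_mul hGi).fun_add (hFi.fun_mul hGr)).congr fun z _ => by simp [mul_im]⟩

/-- Real and imaginary parts of the (total) inverse. -/
theorem sa_inv (hFr : IsSemialgebraicFunOn ℚ W fun z => (F z).re)
    (hFi : IsSemialgebraicFunOn ℚ W fun z => (F z).im) :
    IsSemialgebraicFunOn ℚ W (fun z => (F z)⁻¹.re) ∧
      IsSemialgebraicFunOn ℚ W (fun z => (F z)⁻¹.im) := by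
  have hN := (hFr.fun_mul hFr).fun_add (hFi.fun_mul hFi)
  refine ⟨(hFr.fun_mul hN.fun_inv).congr fun z _ => ?_,
    (hFi.fun_mul hN.fun_inv).fun_neg.congr fun z _ => ?_⟩
  · rw [Complex.inv_re, Complex.normSq_apply]; ring
  · rw [Complex.inv_im, Complex.normSq_apply]; ring

/-- Real and imaginary parts of natural powers. -/
theorem sa_pow (hFr : IsSemialgebraicFunOn ℚ W fun z => (F z).re)
    (hFi : IsSemialgebraicFunOn ℚ W fun z => (F z).im) (n : ℕ) :
    IsSemialgebraicFunOn ℚ W (fun z => (F z ^ n).re) ∧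
      IsSemialgebraicFunOn ℚ W (fun z => (F z ^ n).im) := by
  have hW : IsSemialgebraic ℚ W := IsSemialgebraicFunOn.isSemialgebraic_holds hFr
  induction n with
  | zero =>
    exact ⟨(isSemialgebraicFunOn_const_ratCast hW 1).congr fun z _ => by simp,
      (isSemialgebraicFunOn_const_ratCast hW 0).congr fun z _ => by simp⟩
  | succ n ih =>
    obtain ⟨h1, h2⟩ := sa_mul ih.1 ih.2 hFr hFi
    exact ⟨h1.congr fun z _ => by rw [pow_succ], h2.congr fun z _ => by rw [pow_succ]⟩

/-- A real semialgebraic function, read as complex-valued. -/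
theorem sa_ofReal {f : (Fin d → ℝ) → ℝ} (hf : IsSemialgebraicFunOn ℚ W f) :
    IsSemialgebraicFunOn ℚ W (fun z => ((f z : ℝ) : ℂ).re) ∧
      IsSemialgebraicFunOn ℚ W (fun z => ((f z : ℝ) : ℂ).im) :=
  ⟨hf.congr fun z _ => by simp,
    (isSemialgebraicFunOn_const_ratCast (IsSemialgebraicFunOn.isSemialgebraic_holds hf) 0).congr
      fun z _ => by simp⟩

end Kit

/-! ## The region and the map `z ↦ w = z(1-z)` in real coordinates -/

/-- The closed half-plane `x ≤ 1/2, y ≥ 0` minus the origin, `(x, y) = (z 0, z 1)`. -/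
def Eup : Set (Fin 2 → ℝ) := {z | 0 ≤ z 1 ∧ z 0 ≤ 1 / 2 ∧ (0 < z 1 ∨ z 0 ≠ 0)}

/-- `Eup` is `ℚ`-semialgebraic. -/
theorem isSemialgebraic_Eup : IsSemialgebraic ℚ Eup := by
  have h1 := isSemialgebraic_setOf_eval_nonneg (k := ℚ) (R := ℝ) (X 1 : MvPolynomial (Fin 2) ℚ)
  have h2 := isSemialgebraic_setOf_eval_nonneg (k := ℚ) (R := ℝ)
    (1 - 2 * X 0 : MvPolynomial (Fin 2) ℚ)
  have h3 := isSemialgebraic_setOf_eval_pos (k := ℚ) (R := ℝ) (X 1 : MvPolynomial (Fin 2) ℚ)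
  have h4 := isSemialgebraic_setOf_eval_ne_zero (k := ℚ) (R := ℝ) (X 0 : MvPolynomial (Fin 2) ℚ)
  refine (congrArg (IsSemialgebraic (R := ℝ) ℚ) ?_).mpr (h1.inter (h2.inter (h3.union h4)))
  ext q
  simp only [Eup, mem_setOf_eq, mem_inter_iff, mem_union, map_sub, map_mul, map_one,
    MvPolynomial.aeval_X, map_ofNat]
  constructor
  · rintro ⟨h1, h2, h3⟩; exact ⟨h1, by linarith, h3⟩
  · rintro ⟨h1, h2, h3⟩; exact ⟨h1, by linarith, h3⟩

/-- On `Eup`, `w = z(1-z) ≠ 0`. -/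
theorem wOf_ne_zero_of_mem {z : Fin 2 → ℝ} (hz : z ∈ Eup) : wOf ((z 0 : ℂ) + z 1 * I) ≠ 0 :=
  wOf_ne_zero hz.2.1 hz.2.2 hz.1

/-- `ψ(x, y) = (Re w, Im w) = (x - x² + y², y(1 - 2x))`. -/
def psi (z : Fin 2 → ℝ) : Fin 2 → ℝ := ![z 0 - z 0 ^ 2 + z 1 ^ 2, z 1 * (1 - 2 * z 0)]

/-- `ψ` is a polynomial, hence `ℚ`-semialgebraic, map. -/
theorem isSemialgebraicMapOn_psi : IsSemialgebraicMapOn ℚ Eup psi := by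
  refine IsSemialgebraicMapOn.of_forall isSemialgebraic_Eup fun j => ?_
  fin_cases j
  · exact (isSemialgebraicFunOn_aeval isSemialgebraic_Eup
      (X 0 - X 0 ^ 2 + X 1 ^ 2 : MvPolynomial (Fin 2) ℚ)).congr fun z _ => by simp [psi]
  · exact (isSemialgebraicFunOn_aeval isSemialgebraic_Eup
      (X 1 * (1 - 2 * X 0) : MvPolynomial (Fin 2) ℚ)).congr fun z _ => by simp [psi]

/-- `ψ` maps `Eup` into the closed upper half-plane minus the origin. -/
theorem psi_mapsTo : MapsTo psi Eup upper0 := by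
  intro z hz
  obtain ⟨hy, hx, h0⟩ := hz
  simp only [upper0, mem_setOf_eq, psi, Matrix.cons_val_zero, Matrix.cons_val_one]
  refine ⟨mul_nonneg hy (by linarith), ?_⟩
  rcases hx.lt_or_eq with hx1 | hx1
  · rcases hy.lt_or_eq with hy1 | hy1
    · exact Or.inl (mul_pos hy1 (by linarith))
    · right
      rw [← hy1]
      have hx0 : z 0 ≠ 0 := by
        rcases h0 with h0 | h0
        · exact absurd hy1 h0.ne
        · exact h0
      have hne : z 0 * (1 - z 0) ≠ 0 := mul_ne_zero hx0 (by linarith : (0 : ℝ) < 1 - z 0).ne'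
      intro h
      apply hne
      linear_combination h
  · right
    rw [hx1]
    nlinarith [sq_nonneg (z 1)]

/-- The fifth root of `w`, in real coordinates, factors through `ψ`. -/
theorem root5_wOf_eq (z : Fin 2 → ℝ) :
    root5 (wOf ((z 0 : ℂ) + z 1 * I)) = root5 ((psi z 0 : ℂ) + psi z 1 * I) := by
  simp only [psi, wOf_eq, Matrix.cons_val_zero, Matrix.cons_val_one]

/-- Real and imaginary parts of `w^{1/5}`, `w = z(1-z)`, are semialgebraic on `Eup`. -/
theorem sa_root5_wOf :
    IsSemialgebraicFunOn ℚ Eup (fun z => (root5 (wOf ((z 0 : ℂ) + z 1 * I))).re) ∧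
      IsSemialgebraicFunOn ℚ Eup (fun z => (root5 (wOf ((z 0 : ℂ) + z 1 * I))).im) :=
  ⟨(IsSemialgebraicFunOn.comp_isSemialgebraicMapOn_holds isSemialgebraicFunOn_rootRe
      isSemialgebraicMapOn_psi psi_mapsTo).congr fun z _ => by
        show rootRe (psi z) = _; rw [rootRe, root5_wOf_eq],
    (IsSemialgebraicFunOn.comp_isSemialgebraicMapOn_holds isSemialgebraicFunOn_rootIm
      isSemialgebraicMapOn_psi psi_mapsTo).congr fun z _ => by
        show rootIm (psi z) = _; rw [rootIm, root5_wOf_eq]⟩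

/-- Real and imaginary parts of `w = z(1-z)` are semialgebraic (polynomials). -/
theorem sa_wOf :
    IsSemialgebraicFunOn ℚ Eup (fun z => (wOf ((z 0 : ℂ) + z 1 * I)).re) ∧
      IsSemialgebraicFunOn ℚ Eup (fun z => (wOf ((z 0 : ℂ) + z 1 * I)).im) :=
  ⟨(isSemialgebraicFunOn_aeval isSemialgebraic_Eup
      (X 0 - X 0 ^ 2 + X 1 ^ 2 : MvPolynomial (Fin 2) ℚ)).congr fun z _ => by simp [wOf_re],
    (isSemialgebraicFunOn_aeval isSemialgebraic_Eup
      (X 1 * (1 - 2 * X 0) : MvPolynomial (Fin 2) ℚ)).congr fun z _ => by simp [wOf_im]⟩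

/-- Real and imaginary parts of `1 - 2z` are semialgebraic (polynomials). -/
theorem sa_lin :
    IsSemialgebraicFunOn ℚ Eup (fun z => (1 - 2 * ((z 0 : ℂ) + z 1 * I)).re) ∧
      IsSemialgebraicFunOn ℚ Eup (fun z => (1 - 2 * ((z 0 : ℂ) + z 1 * I)).im) :=
  ⟨(isSemialgebraicFunOn_aeval isSemialgebraic_Eup
      (1 - 2 * X 0 : MvPolynomial (Fin 2) ℚ)).congr fun z _ => by simp,
    (isSemialgebraicFunOn_aeval isSemialgebraic_Eup
      (-(2 * X 1) : MvPolynomial (Fin 2) ℚ)).congr fun z _ => by simp⟩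

/-! ## The integrands at level 5 -/

/-- `P_p(x, y) = Re g_{p/5-1}(x+iy)`. -/
def Pz (p : ℕ) (z : Fin 2 → ℝ) : ℝ := (gPow ((p : ℝ) / 5 - 1) ((z 0 : ℂ) + z 1 * I)).re

/-- `Q_p(x, y) = Im g_{p/5-1}(x+iy)`. -/
def Qz (p : ℕ) (z : Fin 2 → ℝ) : ℝ := (gPow ((p : ℝ) / 5 - 1) ((z 0 : ℂ) + z 1 * I)).im

/-- `h_p(x, y) = -Im g'_{p/5-1}(x+iy)`, the common value of `∂P_p/∂y` and `-∂Q_p/∂x`. -/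
def Hz (p : ℕ) (z : Fin 2 → ℝ) : ℝ := -(gDer ((p : ℝ) / 5 - 1) ((z 0 : ℂ) + z 1 * I)).im

/-- **`P_p` and `Q_p` are `ℚ`-semialgebraic on `Eup`.** -/
theorem sa_PQ (p : ℕ) : IsSemialgebraicFunOn ℚ Eup (Pz p) ∧ IsSemialgebraicFunOn ℚ Eup (Qz p) := by
  obtain ⟨hkr, hki⟩ := sa_root5_wOf
  obtain ⟨hpr, hpi⟩ := sa_pow hkr hki p
  obtain ⟨hwr, hwi⟩ := sa_wOf
  obtain ⟨hir, hii⟩ := sa_inv hwr hwi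
  obtain ⟨hr, hi⟩ := sa_mul hpr hpi hir hii
  refine ⟨hr.congr fun z hz => ?_, hi.congr fun z hz => ?_⟩
  · show _ = (gPow _ _).re
    rw [gPow_eq_root5 p (wOf_ne_zero_of_mem hz), div_eq_mul_inv]
  · show _ = (gPow _ _).im
    rw [gPow_eq_root5 p (wOf_ne_zero_of_mem hz), div_eq_mul_inv]

/-- **`h_p` is `ℚ`-semialgebraic on `Eup`.** -/
theorem sa_Hz (p : ℕ) : IsSemialgebraicFunOn ℚ Eup (Hz p) := by
  obtain ⟨hgr, hgi⟩ := sa_PQ p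
  obtain ⟨hwr, hwi⟩ := sa_wOf
  obtain ⟨hir, hii⟩ := sa_inv hwr hwi
  obtain ⟨h1r, h1i⟩ := sa_mul (F := fun z => gPow ((p : ℝ) / 5 - 1) ((z 0 : ℂ) + z 1 * I))
    hgr hgi hir hii
  obtain ⟨hcr, hci⟩ :=
    sa_ofReal (isSemialgebraicFunOn_const_ratCast isSemialgebraic_Eup ((p : ℚ) / 5 - 1))
  obtain ⟨h2r, h2i⟩ := sa_mul hcr hci h1r h1i
  obtain ⟨hlr, hli⟩ := sa_lin
  obtain ⟨-, h3i⟩ := sa_mul h2r h2i hlr hli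
  refine h3i.fun_neg.congr fun z hz => ?_
  have hc : ((((p : ℚ) / 5 - 1 : ℚ) : ℝ) : ℂ) = (((p : ℝ) / 5 - 1 : ℝ) : ℂ) := by
    push_cast; ring
  show _ = -(gDer _ _).im
  rw [hc, gDer_eq (wOf_ne_zero_of_mem hz)]
  simp only [div_eq_mul_inv]

/-- The values in Cartesian form. -/
theorem Pz_apply (p : ℕ) (x y : ℝ) :
    Pz p ![x, y] = (gPow ((p : ℝ) / 5 - 1) (x + y * I)).re ∧
      Qz p ![x, y] = (gPow ((p : ℝ) / 5 - 1) (x + y * I)).im ∧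
        Hz p ![x, y] = -(gDer ((p : ℝ) / 5 - 1) (x + y * I)).im := by
  simp [Pz, Qz, Hz]

end SoloBlind

end Summit.KontsevichZagierPeriods.KontsevichZagierPeriods.Theorems
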